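import Literature.Geometry.Lorentzian.MinkowskiRadialMultiplier
import Summits.FinalStateConjecture.FinalStateConjecture.Theorems.ClusterCompletenessAdiabaticMultiKerrILEDFlatMorawetzBulk

/-!
# Route ClusterCompleteness — crux `AdiabaticMultiKerrILED`, line `Sketch`: coercivity of a slow timelike multiplier on η

Helper file for the crux `stmt-FinalStateConjecture-14310` (line `Sketch`, research stub
`stub_lateEnergyBound_pos`): on the flat region, the lab-slice energy density `−(J^X)⁰` of a
multiplier `X` whose components at the point form a **slow future vector** (`X⁰ > 0`,
`|X⃗| ≤ ½ X⁰` — e.g. any convex combination of the boosted Killing fields `uᵢ = Λᵢ e₀` with lab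
speeds `≤ ½`, the blended multi-frame field `V = ∑ ζᵢ uᵢ` of the line) is comparable to the
crux's density `∑_μ (∂_μ w)²`:
`¼ X⁰ ∑ (∂w)² ≤ −(J^X)⁰ ≤ ¾ X⁰ ∑ (∂w)²`.
Dafermos–Rodnianski arXiv:0811.0354, App. D (`J^X_μ = T_{μν}X^ν`, positivity for future causal
pairs); the inequality itself is elementary. [folklore]
-/

noncomputable section

-- the doubled `FinalStateConjecture.FinalStateConjecture` path component trips dupNamespace
set_option linter.dupNamespace false

open scoped BigOperators
open Literature.Geometry.Lorentzian

namespace Summit.FinalStateConjecture.FinalStateConjecture.Cruxes.AdiabaticMultiKerrILED.Sketch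

/-- **The lab energy density of a multiplier on Minkowski space**, explicitly: with `p_μ = ∂_μ w`,
`−(J^X)⁰ = ½ X⁰ (p₀² + p₁² + p₂² + p₃²) + p₀ (X¹p₁ + X²p₂ + X³p₃)` (`η = diag(−1,1,1,1)`).
[folklore] -/
theorem neg_multiplierCurrent_eta_zero_eq (X : E4 → Fin 4 → ℝ) (w : E4 → ℝ) (x : E4) :
    -KerrSchild.multiplierCurrent (fun _ ↦ Kerr.etaComp) X w x 0 =
      2⁻¹ * X x 0 * (fderiv ℝ w x (E4.basisVector 0) ^ 2 + fderiv ℝ w x (E4.basisVector 1) ^ 2 +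
          fderiv ℝ w x (E4.basisVector 2) ^ 2 + fderiv ℝ w x (E4.basisVector 3) ^ 2) +
        fderiv ℝ w x (E4.basisVector 0) * (X x 1 * fderiv ℝ w x (E4.basisVector 1) +
          X x 2 * fderiv ℝ w x (E4.basisVector 2) + X x 3 * fderiv ℝ w x (E4.basisVector 3)) := by
  obtain ⟨p, hp⟩ : ∃ p : Fin 4 → ℝ, ∀ β, fderiv ℝ w x (E4.basisVector β) = p β := ⟨_, fun _ ↦ rfl⟩
  simp only [KerrSchild.multiplierCurrent, hp, KerrSchild.etaComp_eq, Fin.sum_univ_four, Fin.isValue]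
  simp only [show (1 : Fin 4) ≠ 0 from by decide, show (2 : Fin 4) ≠ 0 from by decide,
    show (3 : Fin 4) ≠ 0 from by decide, show (0 : Fin 4) ≠ 1 from by decide,
    show (0 : Fin 4) ≠ 2 from by decide, show (0 : Fin 4) ≠ 3 from by decide,
    show (1 : Fin 4) ≠ 2 from by decide, show (1 : Fin 4) ≠ 3 from by decide,
    show (2 : Fin 4) ≠ 1 from by decide, show (2 : Fin 4) ≠ 3 from by decide,
    show (3 : Fin 4) ≠ 1 from by decide, show (3 : Fin 4) ≠ 2 from by decide,
    if_true, if_false]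
  ring

/-- **Coercivity and boundedness of the lab energy density of a slow future multiplier on η**:
if `X⁰ ≥ 0` and `(X¹)² + (X²)² + (X³)² ≤ ¼ (X⁰)²` at the point, then
`¼ X⁰ ∑_μ (∂_μ w)² ≤ −(J^X)⁰ ≤ ¾ X⁰ ∑_μ (∂_μ w)²`. [folklore] -/
theorem neg_multiplierCurrent_eta_zero_bounds (X : E4 → Fin 4 → ℝ) (w : E4 → ℝ) (x : E4)
    (hX0 : 0 ≤ X x 0) (hslow : X x 1 ^ 2 + X x 2 ^ 2 + X x 3 ^ 2 ≤ 4⁻¹ * X x 0 ^ 2) :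
    4⁻¹ * X x 0 * ∑ μ, fderiv ℝ w x (E4.basisVector μ) ^ 2 ≤
        -KerrSchild.multiplierCurrent (fun _ ↦ Kerr.etaComp) X w x 0 ∧
      -KerrSchild.multiplierCurrent (fun _ ↦ Kerr.etaComp) X w x 0 ≤
        3 / 4 * X x 0 * ∑ μ, fderiv ℝ w x (E4.basisVector μ) ^ 2 := by
  rw [neg_multiplierCurrent_eta_zero_eq]
  obtain ⟨p, hp⟩ : ∃ p : Fin 4 → ℝ, ∀ β, fderiv ℝ w x (E4.basisVector β) = p β := ⟨_, fun _ ↦ rfl⟩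
  simp only [hp, Fin.sum_univ_four, Fin.isValue]
  set a := X x 0 with ha
  set b₁ := X x 1
  set b₂ := X x 2
  set b₃ := X x 3
  -- Cauchy–Schwarz: |b·p⃗| ≤ |b| |p⃗| ≤ ½ a |p⃗|, then 2|p₀| (½ a |p⃗|) ≤ ½ a (p₀² + |p⃗|²)... in squared form
  have hcs : (b₁ * p 1 + b₂ * p 2 + b₃ * p 3) ^ 2 ≤
      (b₁ ^ 2 + b₂ ^ 2 + b₃ ^ 2) * (p 1 ^ 2 + p 2 ^ 2 + p 3 ^ 2) := by
    nlinarith [sq_nonneg (b₁ * p 2 - b₂ * p 1), sq_nonneg (b₁ * p 3 - b₃ * p 1),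
      sq_nonneg (b₂ * p 3 - b₃ * p 2)]
  have hS : 0 ≤ p 1 ^ 2 + p 2 ^ 2 + p 3 ^ 2 := by positivity
  have hB : (b₁ * p 1 + b₂ * p 2 + b₃ * p 3) ^ 2 ≤ (2⁻¹ * a) ^ 2 * (p 1 ^ 2 + p 2 ^ 2 + p 3 ^ 2) := by
    refine hcs.trans ?_
    have : b₁ ^ 2 + b₂ ^ 2 + b₃ ^ 2 ≤ (2⁻¹ * a) ^ 2 := by nlinarith [hslow]
    exact mul_le_mul_of_nonneg_right this hS
  -- |p₀ (b·p)| ≤ ¼ a (p₀² + |p⃗|²)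
  have hcross : |p 0 * (b₁ * p 1 + b₂ * p 2 + b₃ * p 3)| ≤
      4⁻¹ * a * (p 0 ^ 2 + (p 1 ^ 2 + p 2 ^ 2 + p 3 ^ 2)) := by
    rw [abs_le]
    set c := b₁ * p 1 + b₂ * p 2 + b₃ * p 3 with hc
    have h2a : 0 ≤ 2⁻¹ * a := by positivity
    -- from c² ≤ (a/2)² S: |c| ≤ (a/2) √S, and 2 |p₀| (a/2)√S ≤ (a/2)(p₀² + S)
    have key : ∀ s : ℝ, s = 1 ∨ s = -1 → s * (p 0 * c) ≤ 4⁻¹ * a * (p 0 ^ 2 + (p 1 ^ 2 + p 2 ^ 2 + p 3 ^ 2)) := by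
      intro s hs
      have hs2 : s ^ 2 = 1 := by rcases hs with h | h <;> simp [h]
      have hsc : (s * c) ^ 2 = c ^ 2 := by rw [mul_pow, hs2, one_mul]
      rcases hX0.eq_or_lt with h0 | hpos
      · -- `a = 0`: then `c = 0`
        have hc0 : c ^ 2 ≤ 0 := by simpa [← h0] using hB
        have hc' : c = 0 := by nlinarith [sq_nonneg c]
        simp [hc', ← h0]
      · have h1 : a * (s * (p 0 * c)) ≤ (2⁻¹ * a) ^ 2 * (p 0 ^ 2 + (p 1 ^ 2 + p 2 ^ 2 + p 3 ^ 2)) := by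
          nlinarith [sq_nonneg (2⁻¹ * a * p 0 - s * c), hB, hsc]
        have h2 : a * (s * (p 0 * c)) ≤ a * (4⁻¹ * a * (p 0 ^ 2 + (p 1 ^ 2 + p 2 ^ 2 + p 3 ^ 2))) := by
          calc _ ≤ _ := h1
            _ = _ := by ring
        exact le_of_mul_le_mul_left h2 hpos
    constructor
    · have := key (-1) (Or.inr rfl); linarith
    · have := key 1 (Or.inl rfl); linarith
  obtain ⟨hlo, hhi⟩ := abs_le.mp hcross
  constructor <;> nlinarith [hlo, hhi, hX0, hS, sq_nonneg (p 0)]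

end Summit.FinalStateConjecture.FinalStateConjecture.Cruxes.AdiabaticMultiKerrILED.Sketch

end
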